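import Literature.AnabelianGeometry.AbsoluteAnabelian.AbsAnabFundamentalGroups
import HarnessLib

/-!
# [AbsAnab] §1.1 — NON-VACUITY of the base-field records `FundamentalExtension.MLFBase` / `NFBase`
# (rows «NV-L4/FundamentalExtension.MLFBase», «NV-L4/FundamentalExtension.NFBase»)

Mochizuki, *The absolute anabelian geometry of hyperbolic curves* [AbsAnab], §1.1 p. 7 ("Suppose that `G` is
equal to `G_F` or `G_𝔭`"), §1.3 p. 18; typed by abc-iut-L4-t4 in `AbsAnabFundamentalGroups.lean` as the records
`E.NFBase = (F, galIso : G ≃ₜ* G_F)` and `E.MLFBase = (p, K, galIso : G ≃ₜ* G_K)` over an extension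
`E : FundamentalExtension` (`1 → Δ → Π → G → 1`, abc-iut-L4-t1). PROOF-ONLY companion (no `def`, no `instance`,
no `structure`). abc-iut-w5-d197's INHABITATION CENSUS L4 v1 (§A) lists both records with ZERO producers: every
[AbsAnab]/[AbsTopI] theorem typed over `(E) (B : E.MLFBase)` / `(B : E.NFBase)` (Lemma 1.1.4, Thm 2.6, …) is, today,
uninstantiated in the kernel. This file records:

* `MLFBase.exists_of_padicField` / `NFBase.exists_of_numberField` — for EVERY finite extension `K/ℚ_p`
  (resp. every number field `F`) there is an extension `E` with `E.gal = G_K` (resp. `G_F`) ON THE NOSE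
  (abc-iut-L4-t1's `absoluteGaloisGrp`, Mathlib's Krull-profinite `Field.absoluteGaloisGroup`) carrying an
  `MLFBase` (resp. `NFBase`) whose `galIso` is the identity. HONEST LABEL: the BASE is GENUINE (the actual
  absolute Galois group of the actual field); the EXTENSION is DEGENERATE — `Π := G`, `aug := id`, so
  `Δ = 1` (no curve is involved; "arising from a hyperbolic curve" is NOT claimed and is exactly what the
  tree's `*Origin`/hypothesis predicates add on top);
* `MLFBase.nonempty_iff` / `NFBase.nonempty_iff` — the EXACT criteria: `E` carries an `MLFBase` iff `E.gal` is
  isomorphic, as a topological group, to `G_K` for some finite `K/ℚ_p` (resp. to `G_F` for some number field);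
* `exists_mlfBase_geom_eq_bot` — the degenerate witness has `Δ = ⊥` (so it is visibly NOT of hyperbolic-curve
  type: consumers that need `Δ ≠ 1` are untouched).

Nothing of [AbsAnab] is asserted; a witness is consistency evidence only. [cite: MochizukiAbsAnab2004, §1.1 p.7]
-/

noncomputable section

namespace Literature.AnabelianGeometry.AbsoluteAnabelian

open Field

universe u

namespace FundamentalExtension

/-! ### The criteria -/

/-- **AbsAnab:§1.1** (kurims p.7) EXACT CRITERION: `E` carries an `MLFBase` iff `G ≅ G_K` (topological groups)
for some prime `p` and some finite extension `K` of `ℚ_p`. [cite: MochizukiAbsAnab2004, §1.3 p.18] -/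
theorem MLFBase.nonempty_iff (E : FundamentalExtension.{u}) :
    Nonempty E.MLFBase ↔
      ∃ (p : ℕ) (_ : Fact p.Prime) (K : Type u) (_ : Field K) (_ : Algebra ℚ_[p] K)
        (_ : FiniteDimensional ℚ_[p] K), Nonempty (E.gal ≃ₜ* absoluteGaloisGroup K) :=
  ⟨fun ⟨B⟩ => ⟨B.p, B.instPrime, B.K, B.instField, B.instAlgebra, B.instFinite, ⟨B.galIso⟩⟩,
    fun ⟨p, hp, K, hK, hA, hF, ⟨e⟩⟩ => ⟨@MLFBase.mk E p hp K hK hA hF e⟩⟩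

/-- **AbsAnab:§1.1** (kurims p.7) EXACT CRITERION: `E` carries an `NFBase` iff `G ≅ G_F` (topological groups) for
some number field `F`. [cite: MochizukiAbsAnab2004, §1.1 p.7] -/
theorem NFBase.nonempty_iff (E : FundamentalExtension.{u}) :
    Nonempty E.NFBase ↔
      ∃ (F : Type u) (_ : Field F) (_ : NumberField F), Nonempty (E.gal ≃ₜ* absoluteGaloisGroup F) :=
  ⟨fun ⟨B⟩ => ⟨B.F, B.instField, B.instNumberField, ⟨B.galIso⟩⟩,
    fun ⟨F, hF, hN, ⟨e⟩⟩ => ⟨@NFBase.mk E F hF hN e⟩⟩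

/-! ### The witnesses: genuine base field, degenerate extension `Π = G` -/

/-- **AbsAnab:§1.3** (kurims p.18) For EVERY finite extension `K` of `ℚ_p` there is an extension `E` with
`E.gal = G_K` (abc-iut-L4-t1's `absoluteGaloisGrp K`) carrying an `MLFBase` with `galIso` the identity. GENUINE
base; DEGENERATE extension (`Π := G_K`, `aug := id`, `Δ = 1` — no curve). `CharZero K` is supplied from
`ℚ_p ↪ K`. [cite: MochizukiAbsAnab2004, §1.3 p.18] -/
theorem MLFBase.exists_of_padicField (p : ℕ) [Fact p.Prime] (K : Type u) [Field K] [Algebra ℚ_[p] K]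
    [FiniteDimensional ℚ_[p] K] :
    ∃ E : FundamentalExtension.{u},
      (E.gal = @absoluteGaloisGrp K _ (charZero_of_injective_algebraMap (algebraMap ℚ_[p] K).injective)) ∧
        Nonempty E.MLFBase := by
  haveI : CharZero K := charZero_of_injective_algebraMap (algebraMap ℚ_[p] K).injective
  refine ⟨{ arith := absoluteGaloisGrp K
            gal := absoluteGaloisGrp K
            aug := ContinuousMonoidHom.id _
            aug_surjective := Function.surjective_id }, rfl, ⟨?_⟩⟩
  exact { p := p, K := K, galIso := ContinuousMulEquiv.refl _ }

/-- **AbsAnab:§1.1** (kurims p.7) For EVERY number field `F` there is an extension `E` with `E.gal = G_F`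
carrying an `NFBase` with `galIso` the identity. GENUINE base; DEGENERATE extension (`Π := G_F`, `Δ = 1`).
[cite: MochizukiAbsAnab2004, §1.1 p.7] -/
theorem NFBase.exists_of_numberField (F : Type u) [Field F] [NumberField F] :
    ∃ E : FundamentalExtension.{u}, E.gal = absoluteGaloisGrp F ∧ Nonempty E.NFBase := by
  refine ⟨{ arith := absoluteGaloisGrp F
            gal := absoluteGaloisGrp F
            aug := ContinuousMonoidHom.id _
            aug_surjective := Function.surjective_id }, rfl, ⟨?_⟩⟩
  exact { F := F, galIso := ContinuousMulEquiv.refl _ }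

/-- **AbsAnab:§1.3** (kurims p.18) On CLOSED TERMS: `MLFBase` is inhabited over the extension `G_{ℚ_p} = G_{ℚ_p}`
(base `K := ℚ_p` itself), for every prime `p`. [cite: MochizukiAbsAnab2004, §1.3 p.18] -/
theorem MLFBase.exists_padic (p : ℕ) [Fact p.Prime] :
    ∃ E : FundamentalExtension.{0}, E.gal = absoluteGaloisGrp ℚ_[p] ∧ Nonempty E.MLFBase := by
  obtain ⟨E, hE, hB⟩ := MLFBase.exists_of_padicField p ℚ_[p]
  exact ⟨E, hE, hB⟩

/-- **AbsAnab:§1.1** (kurims p.7) On CLOSED TERMS: `NFBase` is inhabited over the extension `G_ℚ = G_ℚ`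
(base `F := ℚ`). [cite: MochizukiAbsAnab2004, §1.1 p.7] -/
theorem NFBase.exists_rat : ∃ E : FundamentalExtension.{0}, E.gal = absoluteGaloisGrp ℚ ∧ Nonempty E.NFBase :=
  NFBase.exists_of_numberField ℚ

/-- **AbsAnab:§1.1** (kurims p.7) The degenerate witnesses are visibly NOT of curve type: for every profinite
`G` the extension `(Π := G, aug := id)` has `Δ = ⊥`. (So hypotheses such as `GeomTFG`, slimness of `Δ`, or the
`*Origin` predicates are what separate the intended instances from these.) [cite: MochizukiAbsAnab2004, §1.1 p.7] -/
theorem geom_eq_bot_of_id (G : ProfiniteGrp.{u}) :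
    ({ arith := G, gal := G, aug := ContinuousMonoidHom.id _,
       aug_surjective := Function.surjective_id } : FundamentalExtension.{u}).geom = ⊥ := by
  ext x
  rw [Subgroup.mem_bot, mem_geom]
  rfl

/-- **AbsAnab:§1.3** (kurims p.18) … in particular there is an extension carrying an `MLFBase` whose geometric
part is trivial (for every finite `K/ℚ_p`). [cite: MochizukiAbsAnab2004, §1.3 p.18] -/
theorem exists_mlfBase_geom_eq_bot (p : ℕ) [Fact p.Prime] (K : Type u) [Field K] [Algebra ℚ_[p] K]
    [FiniteDimensional ℚ_[p] K] :
    ∃ E : FundamentalExtension.{u}, E.geom = ⊥ ∧ Nonempty E.MLFBase := by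
  haveI : CharZero K := charZero_of_injective_algebraMap (algebraMap ℚ_[p] K).injective
  exact ⟨_, geom_eq_bot_of_id (absoluteGaloisGrp K), ⟨{ p := p, K := K, galIso := ContinuousMulEquiv.refl _ }⟩⟩

end FundamentalExtension

end Literature.AnabelianGeometry.AbsoluteAnabelian

end
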